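/-
Copyright (c) 2026 the pub-hodgecm-mathlib formalisation cell (harness21).  Prover seat hodgecm-mathlib-K2E2-p03 (g0),
Track B «K2-LIT» ∕ h413 (stmt-HodgeConjecture-24833), line K2_E2 «ThetaExhaustionByRigidity», unit ORIENT, socket #18 (OR-2) — FILE 1∕4:
(N9♯) the conjugate-partner road with ANTIHOLOMORPHIC values recorded.  2026-09-03.
KERNEL module: THEOREMS ONLY (no definition, no named fact, no `sorry`, no instance, no notation).
-/
import Summits.HodgeConjecture.HodgeConjecture.Theorems.F0P2tOccursClauseViaPartner       -- ★ (N9): `occursClause_cohForms_of_semilinear_partner` ∕ `_of_conjPartner_hol`, ★ MirrorAtPinLine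
import HarnessLib

/-!
# K2_E2 road (h413 = stmt-HodgeConjecture-24833), unit ORIENT, socket #18 (OR-2) — file 1∕4: (N9♯) «VIA PARTNER» with ANTIHOLOMORPHIC values

Cell `pub/hodgecm-mathlib` (D-0151), Track B (21-frontier RULING «PUSH BOTH» 2026-09-03, chair K2-lead, dealer K2E2-plan R8 RE-CUT 21:42Z), socket
`Orient.sig_K2E2OrAntiholWitnessOfNeg` of `Cruxes/H413/Lines/K2_E2_ThetaExhaustionByRigidity_Orient.lean` (paid in file 4∕4 `Theorems/K2E2OrAntiholWitnessOfNeg.lean`).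
★ (N9) `F0P2tOccursClauseViaPartner` turns the HOLOMORPHIC occurrence clause of the conjugate partners `ω(μ′, ⟨−a⟩, χ̄)` ([Liu2021, App. D Lem. D.1 (2)], ★
`MirrorAtPinLine.exists_conjPartner_omegaAtLine_neg`: `μ′` of weight one with `Φ_(μ′) = Φ̄_μ`, a bijective conjugate-linear equivariant `J`) into the occurrence
clause of `ω(μ, ⟨a⟩, χ)` via `θ := conjFun ∘ θ′ ∘ J` — whose values lie in the ANTIHOLOMORPHIC summand `conjFun (holCotForms 𝔞)` of `cohForms 𝔞`, a fact ★ (N9)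
states only as `θ v ∈ cohForms 𝔞`.  The socket #18 needs the sharper value module; this file re-proves the two ★ (N9) theorems with it RECORDED (same proofs,
token for token; only the value submodule of the conclusion changes):
* §1 `occursClause_antihol_of_semilinear_partner` — pure algebra (any archimedean factor `𝔞`, any actions `σ, σ′`): values in `(holCotForms 𝔞).map conjFun`.
* §2 `occursClause_antihol_of_conjPartner_hol` — at a packaged CM frame `(L, V)`: the HOLOMORPHIC clause of every conjugate partner `ω(μ′, ⟨−a⟩, χ̄)` gives the
  ANTIHOLOMORPHIC clause of `ω(μ, ⟨a⟩, χ)` (values in `(holCotForms (archFactorOf L V)).map conjFun`).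
Consumer: file 3∕4 `Theorems/K2E2ThetaOccursInGenAntihol.lean` (Case B with antiholomorphic values).

HONEST LABEL: HC_CM is proved only modulo the 7 printed citations (2 remaining named inputs: hLiu418 = stmt-HodgeConjecture-24832,
h413 = stmt-HodgeConjecture-24833) until rung 0 closes; this file is a `--supports stmt-HodgeConjecture-24833` helper and discharges no printed citation by
itself — kernel glue over ★ rows.

## References
* [Liu2021] Y. Liu, *Fourier–Jacobi cycles and arithmetic relative trace formula*, Camb. J. Math. 9 (2021) = arXiv:2102.11518: proof of Prop. 4.13
  («Conversely» l. 2145–2149); Def. 4.11–4.12; App. D §D.1 Steps 1–3, Lem. D.1 (2) (l. 5231), Lem. D.2 (2) p. 127.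
* [GelbartRogawski1991] S. Gelbart, J. Rogawski, Invent. Math. 105 (1991), §3.1 Prop. 3.1.1 p. 455; Remark p. 457.
* [BorelWallach2000] A. Borel, N. Wallach, 2nd ed. (2000), VII 2.10.  [BorelJacquet1979] A. Borel, H. Jacquet, PSPM 33.1 (1979), §4.1, §4.2.
* [PlatonovRapinchuk1994] V. Platonov, A. Rapinchuk (1994), §2.3, §5.1.
-/

set_option autoImplicit false
-- the mandated namespace repeats the single-problem summit's segment (`HodgeConjecture.HodgeConjecture`)
set_option linter.dupNamespace false

noncomputable section

namespace Summit.HodgeConjecture.HodgeConjecture.Cruxes.H413.K2E2OccursClauseAntiholViaPartner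


open NumberField NumberField.InfinitePlace NumberField.ComplexEmbedding NumberField.mixedEmbedding IsDedekindDomain
open scoped Matrix SchwartzMap Classical TensorProduct ComplexConjugate
open Literature.RepresentationTheory
open Literature.NumberTheory.Automorphic Literature.NumberTheory.Automorphic.UnitaryGroup Literature.NumberTheory.Weil1964
open Literature.NumberTheory.GelbartRogawski1991 Literature.NumberTheory.GelbartRogawski1991.UnitaryDualPair
open Literature.NumberTheory.GelbartRogawski1991.UnitaryDualPair.WeilCoinv
open Literature.NumberTheory.GelbartRogawski1991.GRConstruction
open Literature.NumberTheory.Automorphic.Liu2021.Def411WeilCarriersDoubling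
open Literature.NumberTheory.Automorphic.Liu2021.Def411WeilCarriers
open Literature.NumberTheory.Automorphic.IdeleClassGroup
open Literature.NumberTheory.GaloisRepresentations
open Literature.NumberTheory.ComplexMultiplication.CMTypeOps (bar mem_bar_iff)
open Literature.RepresentationTheory.HarrisKudlaSweet1996
open HodgeCM HodgeCM.Model HodgeCM.Model.LiuIndex
open HodgeCM.Model.ArchSideTerm (e₁)
open Summit.HodgeConjecture.CorCM.Transposition.OmegaChiSplitting (sChiD hsChiD)
open Summit.HodgeConjecture.HodgeConjecture.Cruxes.H413.CohFormsCarriers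
open Summit.HodgeConjecture.HodgeConjecture.Cruxes.H413.MirrorAtPinLine

/-! ## §1 Pure algebra: `θ := conjFun ∘ θ′ ∘ J` is valued in the ANTIHOLOMORPHIC summand (★ (N9) §1 with the value module tracked) -/

section Generic

variable (L : HodgeCM.CMField) {ι₁ : (L : Type) →+* ℂ} (V : HodgeCM.HermSpace3 L ι₁) (𝔞 : ArchFactor L V)
  {Ω Ω' : Type} [AddCommGroup Ω] [Module ℂ Ω] [AddCommGroup Ω'] [Module ℂ Ω']

/-- **«VIA PARTNER» (pure algebra), antiholomorphic values recorded** (★ (N9) `occursClause_cohForms_of_semilinear_partner`, same proof, with the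
conclusion `θ v ∈ (holCotForms 𝔞).map conjFun` in place of `θ v ∈ cohForms 𝔞`): a SURJECTIVE conjugate-linear `J : Ω → Ω′` intertwining the actions `σ, σ′` of `U(V)(𝔸_f)` turns a holomorphic
occurrence `θ′` of `Ω′` into the cohomological (antiholomorphic) occurrence `θ := conjFun ∘ θ′ ∘ J` of `Ω`: `ℂ`-linear (two conjugations), non-zero
(`J` onto, `conjFun` injective by ★ `conjFun_conjFun`), valued in `conjFun (holCotForms 𝔞) ≤ cohForms 𝔞`, equivariant by ★ `conjFun_rightRep`.
Programme P4's `viaPartner` (★ `H413HoccGlue.thetaFormsAt_of_hol_of_partner`) with the pin's datum abstracted away.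
[cite: Liu2021, App. D Lem. D.1 (2) (l. 5231), Lem. D.2 (2)] [cite: BorelWallach2000, VII 2.10] -/
theorem occursClause_antihol_of_semilinear_partner (σ : ↥(HodgeCM.HermSpace3.adelicFin V) → Ω → Ω)
    (σ' : ↥(HodgeCM.HermSpace3.adelicFin V) → Ω' → Ω') (J : Ω →ₛₗ[starRingEnd ℂ] Ω') (hJ : Function.Surjective J)
    (hJeq : ∀ (g : ↥(HodgeCM.HermSpace3.adelicFin V)) (v : Ω), J (σ g v) = σ' g (J v))
    (hhol : ∃ θ' : Ω' →ₗ[ℂ] ((adelicDatum L V).Adelic → (Fin 2 → ℂ)), θ' ≠ 0 ∧ (∀ v, θ' v ∈ holCotForms 𝔞) ∧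
      ∀ (g : ↥(HodgeCM.HermSpace3.adelicFin V)) (v : Ω'), θ' (σ' g v) = rightRep L V g (θ' v)) :
    ∃ θ : Ω →ₗ[ℂ] ((adelicDatum L V).Adelic → (Fin 2 → ℂ)), θ ≠ 0 ∧ (∀ v, θ v ∈ (holCotForms 𝔞).map (conjFun L V)) ∧
      ∀ (g : ↥(HodgeCM.HermSpace3.adelicFin V)) (v : Ω), θ (σ g v) = rightRep L V g (θ v) := by
  obtain ⟨θ', hθ', hθ'A, hθ'eq⟩ := hhol
  -- the conjugate sandwich `v ↦ conj (θ' (J v))` is ℂ-linear (two conjugations)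
  let S : Ω →ₗ[ℂ] ((adelicDatum L V).Adelic → (Fin 2 → ℂ)) :=
    { toFun := fun v => conjFun L V (θ' (J v))
      map_add' := fun v w => by simp only [map_add]
      map_smul' := fun c v => by simp only [LinearMap.map_smulₛₗ, RingHom.id_apply, starRingEnd_self_apply] }
  have hS : ∀ v, S v = conjFun L V (θ' (J v)) := fun _ => rfl
  refine ⟨S, ?_, fun v => ?_, fun g v => ?_⟩
  · -- non-vanishing
    obtain ⟨w, hw⟩ : ∃ w, θ' w ≠ 0 := by
      by_contra hall
      push Not at hall
      exact hθ' (LinearMap.ext hall)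
    obtain ⟨v, rfl⟩ := hJ w
    intro hzero
    apply hw
    have h1 : conjFun L V (θ' (J v)) = 0 := by
      have := LinearMap.congr_fun hzero v
      simpa only [hS, LinearMap.zero_apply] using this
    have h2 : conjFun L V (θ' (J v)) = conjFun L V 0 := by rw [h1, map_zero]
    exact (Function.LeftInverse.injective (conjFun_conjFun L V)) h2
  · -- values in `conjFun (holCotForms 𝔞)` — the antiholomorphic summand, RECORDED (★ (N9) §1 blurs it to `cohForms 𝔞`)
    simp only [hS]
    exact Submodule.mem_map_of_mem (hθ'A (J v))
  · -- equivariance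
    simp only [hS, hJeq, hθ'eq]
    exact conjFun_rightRep L V g (θ' (J v))


end Generic


/-! ## §2 At a packaged CM frame: `ω(μ, ⟨a⟩, χ)` occurs ANTIHOLOMORPHICALLY if its conjugate partners `ω(μ′, ⟨−a⟩, χ̄)` occur holomorphically -/

section Partner

variable {L : HodgeCM.CMField} {ι₁ : (L : Type) →+* ℂ} (V : HodgeCM.HermSpace3 L ι₁)

set_option synthInstance.maxHeartbeats 400000 in
set_option maxHeartbeats 8000000 in
-- heartbeats: the carriers `omegaAtLine … (hsChiD …)` elaborate the χ-attached splitting datum (same budget as ★ `exists_conjPartner_omegaAtLine_neg`).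
/-- **the ANTIHOLOMORPHIC clause for `ω(μ, ⟨a⟩, χ)` (values in `(holCotForms (archFactorOf L V)).map conjFun`) from the HOLOMORPHIC clause of the conjugate
partners `ω(μ′, ⟨−a⟩, χ̄)`** — ★ (N9) `occursClause_cohForms_of_conjPartner_hol` with the value module recorded (`μ′` of weight one with `HasCMType μ′ Φ̄_μ`; hypothesis shape = the conclusion of ★ ENGINE-GEN
`exists_holTheta_atFrame_of_chiN` at `(μ′, χ̄, −a)`, conclusion shape = the input `hE` of ★ (Ta) `occursClause_cohForms_frame_of_archFactorOf`).
Proof: ★ `exists_conjPartner_omegaAtLine_neg` (a bijective conjugate-linear `U(V)(𝔸_f)`-equivariant `J`, [Liu2021, Lem. D.1 (2)]) ▸ §1 at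
`σ g := rhoVAtLine … a χ (ιVE V g)`, `σ′ g := rhoVAtLine … (−a) χ̄ (ιVE V g)`.
[cite: Liu2021, App. D Lem. D.1 (2) (l. 5231), Lem. D.2 (2); proof of Prop. 4.13 l. 2145] [cite: BorelWallach2000, VII 2.10]
[cite: GelbartRogawski1991, §3.1 Prop. 3.1.1 p. 455] -/
theorem occursClause_antihol_of_conjPartner_hol
    (μ : Literature.NumberTheory.Automorphic.IdeleClassGroup (L : Type) →ₜ* Circle) (hμ : IsConjugateSymplectic (L : Type) μ)
    (hw : HasWeight (L : Type) μ 1) {Φ : Literature.AlgebraicGeometry.Motives.CMType (L : Type)} (hΦμ : HasCMType (L : Type) μ Φ)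
    (a : (↥(maximalRealSubfield (L : Type)))ˣ) (χ : Chi ↥(maximalRealSubfield (L : Type)) (L : Type) (IsCMField.complexConj (L : Type)))
    (hhol : ∀ (μ' : Literature.NumberTheory.Automorphic.IdeleClassGroup (L : Type) →ₜ* Circle) (hμ' : IsConjugateSymplectic (L : Type) μ'),
      HasWeight (L : Type) μ' 1 → HasCMType (L : Type) μ' (bar Φ) →
      ∃ θ' : omegaAtLine ↥(maximalRealSubfield (L : Type)) (L : Type) (IsCMField.complexConj (L : Type)) 3 e₁ (Matrix.diagonal (frameD V))
          (complexConj_imagUnit (L : Type)) (imagUnit_ne_zero (L : Type)) (imagUnit_mul_self (L : Type))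
          (realDiagonal_isSymm (L : Type) (frameD V) (frameD_real V)) (isUnit_det_realDiagonal (L : Type) (frameD V) (frameD_real V) (frameD_ne V))
          (realDiagonal_map (L : Type) (frameD V) (frameD_real V)).symm
          (hsChiD (⟨HodgeCM.CMField.K L⟩ : Summit.HodgeConjecture.CorCM.CMField) e₁ (frameD V) (frameD_real V) (frameD_ne V)
            (toHeckeCharacter (L : Type) μ') (isUnitary_toHeckeCharacter (L : Type) μ') (isSplittingChar_toHeckeCharacter_of_isConjugateSymplectic (L : Type) μ' hμ')) (-a)
          ⟨(Units.map ((starRingEnd ℂ : ℂ →+* ℂ) : ℂ →* ℂ)).comp χ.1,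
              isAutomorphicOneChar_unitsMap_comp_chi (IsCMField.complexConj (L : Type)) χ _⟩ →ₗ[ℂ] ((adelicDatum L V).Adelic → (Fin 2 → ℂ)),
        θ' ≠ 0 ∧ (∀ v, θ' v ∈ holCotForms (archFactorOf L V)) ∧
          ∀ (g : ↥(HodgeCM.HermSpace3.adelicFin V))
            (v : omegaAtLine ↥(maximalRealSubfield (L : Type)) (L : Type) (IsCMField.complexConj (L : Type)) 3 e₁ (Matrix.diagonal (frameD V))
              (complexConj_imagUnit (L : Type)) (imagUnit_ne_zero (L : Type)) (imagUnit_mul_self (L : Type))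
              (realDiagonal_isSymm (L : Type) (frameD V) (frameD_real V)) (isUnit_det_realDiagonal (L : Type) (frameD V) (frameD_real V) (frameD_ne V))
              (realDiagonal_map (L : Type) (frameD V) (frameD_real V)).symm
              (hsChiD (⟨HodgeCM.CMField.K L⟩ : Summit.HodgeConjecture.CorCM.CMField) e₁ (frameD V) (frameD_real V) (frameD_ne V)
                (toHeckeCharacter (L : Type) μ') (isUnitary_toHeckeCharacter (L : Type) μ') (isSplittingChar_toHeckeCharacter_of_isConjugateSymplectic (L : Type) μ' hμ')) (-a)
              ⟨(Units.map ((starRingEnd ℂ : ℂ →+* ℂ) : ℂ →* ℂ)).comp χ.1,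
              isAutomorphicOneChar_unitsMap_comp_chi (IsCMField.complexConj (L : Type)) χ _⟩),
            θ' (rhoVAtLine ↥(maximalRealSubfield (L : Type)) (L : Type) (IsCMField.complexConj (L : Type)) 3 e₁ (Matrix.diagonal (frameD V))
                  (complexConj_imagUnit (L : Type)) (imagUnit_ne_zero (L : Type)) (imagUnit_mul_self (L : Type))
                  (realDiagonal_isSymm (L : Type) (frameD V) (frameD_real V)) (isUnit_det_realDiagonal (L : Type) (frameD V) (frameD_real V) (frameD_ne V))
                  (realDiagonal_map (L : Type) (frameD V) (frameD_real V)).symm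
                  (hsChiD (⟨HodgeCM.CMField.K L⟩ : Summit.HodgeConjecture.CorCM.CMField) e₁ (frameD V) (frameD_real V) (frameD_ne V)
                    (toHeckeCharacter (L : Type) μ') (isUnitary_toHeckeCharacter (L : Type) μ') (isSplittingChar_toHeckeCharacter_of_isConjugateSymplectic (L : Type) μ' hμ')) (-a)
                  ⟨(Units.map ((starRingEnd ℂ : ℂ →+* ℂ) : ℂ →* ℂ)).comp χ.1,
              isAutomorphicOneChar_unitsMap_comp_chi (IsCMField.complexConj (L : Type)) χ _⟩ (ιVE V g) v) = rightRep L V g (θ' v)) :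
    ∃ θ : omegaAtLine ↥(maximalRealSubfield (L : Type)) (L : Type) (IsCMField.complexConj (L : Type)) 3 e₁ (Matrix.diagonal (frameD V))
          (complexConj_imagUnit (L : Type)) (imagUnit_ne_zero (L : Type)) (imagUnit_mul_self (L : Type))
          (realDiagonal_isSymm (L : Type) (frameD V) (frameD_real V)) (isUnit_det_realDiagonal (L : Type) (frameD V) (frameD_real V) (frameD_ne V))
          (realDiagonal_map (L : Type) (frameD V) (frameD_real V)).symm
          (hsChiD (⟨HodgeCM.CMField.K L⟩ : Summit.HodgeConjecture.CorCM.CMField) e₁ (frameD V) (frameD_real V) (frameD_ne V)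
            (toHeckeCharacter (L : Type) μ) (isUnitary_toHeckeCharacter (L : Type) μ) (isSplittingChar_toHeckeCharacter_of_isConjugateSymplectic (L : Type) μ hμ)) a
          χ →ₗ[ℂ] ((adelicDatum L V).Adelic → (Fin 2 → ℂ)),
      θ ≠ 0 ∧ (∀ v, θ v ∈ (holCotForms (archFactorOf L V)).map (conjFun L V)) ∧
        ∀ (g : ↥(HodgeCM.HermSpace3.adelicFin V))
          (v : omegaAtLine ↥(maximalRealSubfield (L : Type)) (L : Type) (IsCMField.complexConj (L : Type)) 3 e₁ (Matrix.diagonal (frameD V))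
            (complexConj_imagUnit (L : Type)) (imagUnit_ne_zero (L : Type)) (imagUnit_mul_self (L : Type))
            (realDiagonal_isSymm (L : Type) (frameD V) (frameD_real V)) (isUnit_det_realDiagonal (L : Type) (frameD V) (frameD_real V) (frameD_ne V))
            (realDiagonal_map (L : Type) (frameD V) (frameD_real V)).symm
            (hsChiD (⟨HodgeCM.CMField.K L⟩ : Summit.HodgeConjecture.CorCM.CMField) e₁ (frameD V) (frameD_real V) (frameD_ne V)
              (toHeckeCharacter (L : Type) μ) (isUnitary_toHeckeCharacter (L : Type) μ) (isSplittingChar_toHeckeCharacter_of_isConjugateSymplectic (L : Type) μ hμ)) a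
            χ),
          θ (rhoVAtLine ↥(maximalRealSubfield (L : Type)) (L : Type) (IsCMField.complexConj (L : Type)) 3 e₁ (Matrix.diagonal (frameD V))
                (complexConj_imagUnit (L : Type)) (imagUnit_ne_zero (L : Type)) (imagUnit_mul_self (L : Type))
                (realDiagonal_isSymm (L : Type) (frameD V) (frameD_real V)) (isUnit_det_realDiagonal (L : Type) (frameD V) (frameD_real V) (frameD_ne V))
                (realDiagonal_map (L : Type) (frameD V) (frameD_real V)).symm
                (hsChiD (⟨HodgeCM.CMField.K L⟩ : Summit.HodgeConjecture.CorCM.CMField) e₁ (frameD V) (frameD_real V) (frameD_ne V)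
                  (toHeckeCharacter (L : Type) μ) (isUnitary_toHeckeCharacter (L : Type) μ) (isSplittingChar_toHeckeCharacter_of_isConjugateSymplectic (L : Type) μ hμ)) a
                χ (ιVE V g) v) = rightRep L V g (θ v) := by
  obtain ⟨μ', hμ', hw', hΦ', J, hJ, hJeq⟩ :=
    exists_conjPartner_omegaAtLine_neg V μ hμ hw hΦμ (isSplittingChar_toHeckeCharacter_of_isConjugateSymplectic (L : Type) μ hμ) a χ
  exact occursClause_antihol_of_semilinear_partner L V (archFactorOf L V) (fun g v => _) (fun g v => _) J hJ.2
    (fun g v => hJeq (ιVE V g) v) (hhol μ' hμ' hw' hΦ')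


end Partner

end Summit.HodgeConjecture.HodgeConjecture.Cruxes.H413.K2E2OccursClauseAntiholViaPartner

end
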